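import Summits.BirchSwinnertonDyer.Rank1Residual.GaloisImage.KuriharaRecordCorollaryThreeDeep
import Summits.BirchSwinnertonDyer.Rank1Residual.GaloisImage.KuriharaRecordBSDpThreeLevelTwoEndNoEP
import Summits.BirchSwinnertonDyer.BirchSwinnertonDyer.Theorems.KimAtThreeDeepLowerKatoStratumOfFacts
import Summits.BirchSwinnertonDyer.BirchSwinnertonDyer.Theorems.KimAtThreeKolyvaginMinimalCertificate
import HarnessLib

/-!
# Crux `DeepLowerAtThree` (item 19075) for EVERY `t` on the additive `3 ∤ c₃` tower stratum at ANY
# conductor, with the Manin condition `3 ∤ c_D` DISPLAYED (no Cremona range, no `h26`, no `hmod`,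
# no `hEP`) — route W2 `KimAtThreeKolyvagin`, cell `bsd-addord`, seat w2-c2 (D-0074 row B5)

HONEST FRAMING. Theorems only (no definition, no named fact minted, no `sorry`); nothing asserted,
nothing booked; crux 19075 stays OPEN. Companion of `KimAtThreeDeepLowerDeepPortStratum.lean` (this
seat), which obtains 19075's conclusion for all `t` through cell n1011's Cremona-range record corollary
`Assembly.exists_LOmega_padicValRat_le_of_towerSurj_deep` (`N ≤ 130000`, `h26`, `hmod`). Here the
record corollary is RE-RUN (proof adapted verbatim from
`Rank1Residual/GaloisImage/KuriharaRecordCorollaryThreeDeep.lean`, credit cell b2b-bsdres team n1011,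
seats p15/p18) with the Manin datum carried as the two binders `3 ∤ c_D` and the `3`-adic period transfer
`Ω(W) = u·Ω⁺_{D.f}`, `|u|₃ = 1` (kim3's convention for the `t = 0` rung), `L(E,1) ≠ 0` in place of
`analyticRank = 0` + modularity, Tate's local Euler–Poincaré characteristic discharged by name
(`Assembly.localEulerPoincareCharacteristic_rat`), and the Poitou–Tate families from the named fact
`poitouTate_selmerStructure_duality ℚ`. PRICE (by name, nothing asserted): the two S24-DEEP ports
`hS24d`/`hS24d₂` (FLAG `S24-DEEP-PORT@3`, not the printed [S24] Thm. 4.4), GZK `hGZK`, Poitou–Tate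
`hPT`, ONE unrepaired dictionary port `KatoKuriharaPortThreeAt W t v₃` (FLAG `K22-Thm3.13-PORT@3`).
ROW: tower, ADDITIVE `3`, `3 ∤ c₃`, `#E(ℚ₃)[3] = 3^t`, datum `D` at the conductor with `3 ∤ c_D`.

* `exists_LOmega_padicValRat_le_of_towerSurj_deep_of_manin` — Cor C-t in BSD currency, all `t`, all
  depths: a MINIMAL certificate of modulus `3^j` at a cyclic `n ∈ 𝒩_{k+t+1}(E,3)`, `t + j ≤ k + 1`,
  forces `ord₃(L(E,1)/Ω(W)) ≤ ord₃ #Ш(E/ℚ)(3) + (j − 1)`;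
* `deepLower_datum_of_deepPorts_of_manin` — 19075's conclusion for `(W, D.f)` (kim3's END-shape bridge
  at `K = 2t + 1`); `deepLower_optimal_of_deepPorts_of_manin` — the same for an OPTIMAL datum with
  `3 ∤ c_D` (period transfer by `X4.periodTransfer_of_optimal`).

References: [Kim2025RefinedTNC] Thm 1.1; [Kim2022StructureSelmer] Thm. 1.9 (6), Thm. 3.13;
[Sakamoto2024] Thm. 4.4; [MazurRubin2004] §3.5 (H.5), Thm. 3.2.4, Prop. A.2, Thm. 5.2.12;
[MilneADT2006] I Thm. 4.10; memo `run/shared/lean/pub/bsd-addord/kim3/KIM3-PROOF.md` §14, §16.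
-/

-- the Theorems namespace of a single-conjunct summit repeats the summit name by design (D-0017)
set_option linter.dupNamespace false

noncomputable section

open scoped Classical NumberField ContRepresentation
open Function Field NumberField IsDedekindDomain IsDedekindDomain.HeightOneSpectrum WeierstrassCurve
  CongruenceSubgroup
  Literature.NumberTheory.EllipticCurves Literature.NumberTheory.EllipticCurves.ModularForms
  Literature.NumberTheory.EllipticCurves.Rank1Residual
  Literature.NumberTheory.GaloisRepresentations
  Literature.NumberTheory.GaloisRepresentations.DiscreteGaloisModule Literature.NumberTheory.GaloisCohomology
  Rat.HeightOneSpectrum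
  Summit.BirchSwinnertonDyer.Rank1Residual.GaloisImage
  Summit.BirchSwinnertonDyer.Rank1Residual.GaloisImage.Assembly
  Summit.BirchSwinnertonDyer.Rank1Residual.X4
  Summit.BirchSwinnertonDyer.BirchSwinnertonDyer.Theorems.KimAtThreeKolyvaginUnitLevelOneRungs
  Summit.BirchSwinnertonDyer.BirchSwinnertonDyer.Theorems.KimAtThreeKolyvaginMinimalCertificate
  Summit.BirchSwinnertonDyer.BirchSwinnertonDyer.Theorems.KimAtThreeDeepLowerKatoStratumOfFacts

namespace Summit.BirchSwinnertonDyer.BirchSwinnertonDyer.Theorems.KimAtThreeDeepLowerDeepPortManin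

/-- **Cor C-t in BSD currency for every `t` and every depth, Manin datum displayed** — cell n1011's
`Assembly.exists_LOmega_padicValRat_le_of_towerSurj_deep` with (`N ≤ 130000`, `h26`, `hopt`) replaced by
`3 ∤ c_D` + the period transfer, (`analyticRank = 0`, `hmod`) by `L(E,1) ≠ 0`, `hEP` discharged, and the
Poitou–Tate families from `hPT`; proof otherwise verbatim (adapted from
`Rank1Residual/GaloisImage/KuriharaRecordCorollaryThreeDeep.lean`, credit cell b2b-bsdres n1011): `W/ℚ`
globally minimal, ADDITIVE at `3` with `3 ∤ c₃`, the `3`-adic tower, `#E(ℚ₃)[3] = 3^t`, `L(E,1) ≠ 0`, a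
datum `D` with `3 ∤ c_D` and the period transfer; the ports; a depth `k`, modulus `3^j`, `t + j ≤ k + 1`,
and a MINIMAL certificate at a cyclic `n ∈ 𝒩_{k+t+1}(E,3)` with `ℓ ∤ N` for `ℓ ∣ n` ⟹
`∃ q, L(E,1)/Ω(W) = q ∧ ord₃ q ≤ ord₃ #Ш(E/ℚ)(3) + (j − 1)`.
[cite: Kim2022StructureSelmer, Thm. 1.9 (6) and Thm. 3.13] [cite: Sakamoto2024, Thm. 4.4 (p. 926)]
[cite: MazurRubin2004, §3.5 (H.5) (p. 27) and Prop. A.2 (pp. 79–80)] [cite: MilneADT2006, Ch. I, Thm. 4.10] -/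
theorem exists_LOmega_padicValRat_le_of_towerSurj_deep_of_manin
    (hS24d : S24Deep.kolyvaginSystems_freeRankOne_zmod_three_pow_deep)
    (hS24d₂ : S24Deep.kolyvaginSystems_idealOfBasis_eq_fittingIdeal_zmod_three_pow_deep)
    (hGZK : rank_eq_analyticRank_of_analyticRank_le_one)
    (hPT : poitouTate_selmerStructure_duality ℚ)
    (W : WeierstrassCurve ℚ) [W.IsElliptic] [W.IsGloballyMinimal] (t k : ℕ)
    -- the row
    (hadd : haveI : Fact (Nat.Prime 3) := ⟨Nat.prime_three⟩; Addv W 3)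
    (hc3 : ¬ 3 ∣ (W.baseChange ℚ_[3]).localTamagawaNumber ℤ_[3])
    (htower : ∀ m : ℕ, W.HasSurjectiveModNGaloisRep (3 ^ m : ℕ))
    (ht : Nat.card {Q : (W.baseChange ℚ_[3]).toAffine.Point // (3 : ℕ) • Q = 0} = 3 ^ t)
    (hL : W.entireLFunction 1 ≠ 0)
    {N : ℕ} [NeZero N] (D : ModularParametrizationData W N)
    (hcD : ¬ (3 : ℤ) ∣ D.maninConstant)
    (hper : ∃ u : ℚ, ‖(u : ℚ_[3])‖ = 1 ∧ W.realPeriodRat = u * plusPeriod D.f)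
    -- ONE dictionary port
    (v₃ : HeightOneSpectrum (𝓞 ℚ)) (hv₃ : ((3 : ℕ) : 𝓞 ℚ) ∈ v₃.asIdeal)
    (hPort : KatoKuriharaPortThreeAt W t v₃)
    -- the certificate at `n ∈ 𝒩_{k+t+1}`, modulus `3^j`, `t + j ≤ k + 1`
    (n : ℕ) [NeZero n] (hn : Kato.IsKolyvaginProduct W 3 (k + t + 1) n)
    (hcyc : ∀ (ℓ : ℕ) [Fact ℓ.Prime], ℓ ∣ n →
      Nat.card {P : ((integralModelInt W).map (Int.castRingHom (ZMod ℓ))).toAffine.Point //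
        3 • P = 0} ≤ 3)
    (hnN : ∀ ℓ ∈ n.primeFactors, ¬ ℓ ∣ N) {j : ℕ} (htj : t + j ≤ k + 1)
    (ψ : (ℓ : ℕ) → (ZMod ℓ)ˣ →* Multiplicative (ZMod (3 ^ j)))
    (hψ : ∀ ℓ ∈ n.primeFactors, Function.Surjective (ψ ℓ))
    (hcert : kuriharaNumber D.f (3 ^ j) n ψ ≠ 0)
    (hv : ∀ d : ℕ, d ∣ n → 1 < d → d < n → ∀ [NeZero d], kuriharaNumber D.f (3 ^ j) d ψ = 0) :
    ∃ q : ℚ, W.entireLFunction 1 / (W.realPeriodRat : ℂ) = (q : ℂ) ∧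
      padicValRat 3 q ≤
        (padicValNat 3 (Nat.card (AddCommGroup.primaryComponent W.sha 3)) : ℤ) + ((j - 1 : ℕ) : ℤ) := by
  haveI : Fact (Nat.Prime 3) := ⟨Nat.prime_three⟩
  -- the row: analytic rank `0`, `E(ℚ)` and `Ш` finite, surj(3)
  have hr : W.analyticRank = 0 := analyticRank_eq_zero_of_entireLFunction_one_ne_zero hL
  have hGZ := hGZK W (by rw [hr]; exact zero_le_one)
  haveI : Finite W.sha := hGZ.2
  haveI : Finite W.toAffine.Point := W.mordellWeilRank_eq_zero_iff_holds.mp (by rw [hGZ.1, hr])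
  have hsurj : W.HasSurjectiveModNGaloisRep ((3 : ℕ) : ℤ) := by simpa using htower 1
  have hcP : ¬ ((3 : ℕ) : ℤ) ∣ D.maninConstant := by exact_mod_cast hcD
  -- the Poitou–Tate families (named fact) and Tate's local Euler–Poincaré characteristic (theorem)
  obtain ⟨inv, hperf, hsum, -, hcompl⟩ := hPT 3
  obtain ⟨inv', hperf', hsum', hcompl', hinj'⟩ := exists_localInvariants_three_pow_of_poitouTate hPT
  have hEP : ∀ v : HeightOneSpectrum (𝓞 ℚ), localEulerPoincareCharacteristic (v.adicCompletion ℚ) :=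
    localEulerPoincareCharacteristic_rat
  -- the admissible set `T = {v ∣ 3} ∪ {bad}` and `S = S(T)` (adapted from n1011, verbatim)
  obtain ⟨T, h3T, hbadT, hTmem, hT, h𝓕T, h𝓚T, hfinT, hfinS⟩ := TowerPackage.towerAdmissible W
  have hS : ∀ w : InfinitePlace ℚ, (Sum.inl w : Place ℚ) ∈ finSupport T := inl_mem_finSupport T
  have h3S : ∀ v : HeightOneSpectrum (𝓞 ℚ), ((3 : ℕ) : 𝓞 ℚ) ∈ v.asIdeal →
      (Sum.inr v : Place ℚ) ∈ finSupport T := fun v hv => (inr_mem_finSupport_iff T v).mpr (h3T v hv)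
  have hbadS : ∀ v : HeightOneSpectrum (𝓞 ℚ), ¬ W.HasGoodReductionAt v →
      (Sum.inr v : Place ℚ) ∈ finSupport T := fun v hv => (inr_mem_finSupport_iff T v).mpr (hbadT v hv)
  have hSgood : ∀ v ∉ {v : HeightOneSpectrum (𝓞 ℚ) | (Sum.inr v : Place ℚ) ∈ finSupport T},
      W.HasGoodReductionAt v ∧ ((3 : ℕ) : 𝓞 ℚ) ∉ v.asIdeal := fun v hv =>
    ⟨by_contra fun h => hv (hbadS v h), fun h => hv (h3S v h)⟩
  -- ONE `τ` for all levels, and the deep family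
  obtain ⟨τ, hτμ, hτq⟩ := S24Deep.exists_tau_forall_levels_of_towerSurj W htower
  obtain ⟨η, D', g', hP', hDT', hD', hPP', hPS', hUT', hg', hgo', hgen', hR22'⟩ :=
    S24Deep.exists_deepFamily_of_towerSurj W hS24d hS24d₂ t k htower τ hτμ hτq inv hperf hsum hcompl
      hEP (finSupport T) hS h3S hbadS hfinT
  -- the reduction maps
  choose red hred using fun k' => exists_torsionReduction_three W k k'
  -- the guards
  have hguard : ∀ k' m, m ≤ max k k' + t → (D' k').IsCanonicalTauDatumThreeAt W m k' :=
    fun k' m hm => ⟨hDT' k', ⟨η k', hD' k'⟩, _, τ, hSgood, hτμ _, hτq _, (hP' k').le.trans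
      (S24Deep.frobeniusClassPrimes_torsion_pow_mul_mono W ((3 : ℕ) : ℤ) hm _ τ
        (pow_dvd_pow 3 (by omega)))⟩
  have hdict := hPort.dictionary₂ (hguard k (k + t) (by omega)) (fun k' => hguard k' (k' + t) (by omega))
    red
  -- surjectivity at the class level `3^{k+t+1}` from the tower
  have hsurjK : W.HasSurjectiveModNGaloisRep (((3 : ℕ) : ℤ) ^ (max k k + t) * ((3 : ℕ) : ℤ)) := by
    simpa only [Nat.cast_pow, Nat.cast_mul, pow_succ] using htower (max k k + t + 1)
  have hn' : Kato.IsKolyvaginProduct W 3 (max k k + t + 1) n := by rw [max_self]; exact hn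
  -- n1011's END theorem with everything discharged
  exact padicValRat_le_of_kolyvaginProduct_deep W t k (max k k + t) (D' k) v₃ hv₃ hadd hc3 hsurj ht hL D
    hcP hper (hDT' k) (g' k) (hg' k) (hgen' k) D' hDT' hPP' red hred hdict g' hg' hgo' hgen' inv' hperf'
    hsum' hcompl' hinj' hEP (fun _ => T) (fun _ => h3T v₃ hv₃) hT h𝓕T h𝓚T hfinT hfinS
    (fun q hq => fun h => hPS' k q hq ((inr_mem_finSupport_iff T q).mpr h))
    (fun k' q hq => fun h => hPS' k' q hq ((inr_mem_finSupport_iff T q).mpr h))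
    (hUT' k) hUT'
    (fun d hd => hR22' k (inv' k) (hperf' k) (hsum' k) (hcompl' k) d hd)
    (fun k' d hd => hR22' k' (inv' k') (hperf' k') (hsum' k') (hcompl' k') d hd)
    (hτμ _) (hτq _) (hP' k) hsurjK n hn'
    (fun v hv => natCard_torsionBy_reductionAt_le_of_dvd W 3 hcyc hv)
    (fun v hv h => by
      obtain ⟨hgood, h3⟩ := hasGoodReductionAt_and_not_mem_of_kolyvaginProduct W 3 hn hv
      rcases hTmem v ((inr_mem_finSupport_iff T v).mp h) with hbad | h3v
      · exact hbad hgood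
      · exact h3 h3v)
    hnN htj ψ hψ hcert hv

/-- **Crux `DeepLowerAtThree` for every `t` at any conductor, GRANTED the deep ports, Manin datum
displayed.** For `W/ℚ` globally minimal, ADDITIVE at `3` with `3 ∤ c₃`, the `3`-adic tower onto,
`#E(ℚ₃)[3] = 3^t`, a parametrisation datum `D` at the conductor (`N = N_E`) with `3 ∤ c_D` and the period
transfer, and `ord(δ̃) = 0`; GRANTED `hS24d`/`hS24d₂`, `hGZK`, `hPT` and ONE port
`KatoKuriharaPortThreeAt W t v₃`: `∂^{(∞)}_deep(δ̃) = d ∈ ℕ` and `∂⁽⁰⁾(δ̃) ≤ ord₃ #Ш(E/ℚ)(3) + d` for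
`(W, D.f)` — kim3's `deepLower_datum_of_endShapeBound` at `K = 2t + 1` over
`exists_LOmega_padicValRat_le_of_towerSurj_deep_of_manin` at `k = L − t − 1`. Nothing asserted.
[cite: Kim2025RefinedTNC, Thm 1.1] [cite: Kim2022StructureSelmer, Thm. 1.9 (6), Thm. 3.13]
[cite: Sakamoto2024, Thm. 4.4 (p. 926)] [cite: MazurRubin2004, Thm. 5.2.12, Cor. 5.2.13] -/
theorem deepLower_datum_of_deepPorts_of_manin
    (hS24d : S24Deep.kolyvaginSystems_freeRankOne_zmod_three_pow_deep)
    (hS24d₂ : S24Deep.kolyvaginSystems_idealOfBasis_eq_fittingIdeal_zmod_three_pow_deep)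
    (hGZK : rank_eq_analyticRank_of_analyticRank_le_one)
    (hPT : poitouTate_selmerStructure_duality ℚ)
    (W : WeierstrassCurve ℚ) [W.IsElliptic] [W.IsGloballyMinimal] (t : ℕ)
    (hadd : haveI : Fact (Nat.Prime 3) := ⟨Nat.prime_three⟩; Addv W 3)
    (hc3 : ¬ 3 ∣ (W.baseChange ℚ_[3]).localTamagawaNumber ℤ_[3])
    (htower : ∀ m : ℕ, W.HasSurjectiveModNGaloisRep (3 ^ m : ℕ))
    (ht : Nat.card {Q : (W.baseChange ℚ_[3]).toAffine.Point // (3 : ℕ) • Q = 0} = 3 ^ t)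
    {N : ℕ} [NeZero N] (hNc : N = W.conductorNorm ℤ) (D : ModularParametrizationData W N)
    (hcD : ¬ (3 : ℤ) ∣ D.maninConstant)
    (hper : ∃ u : ℚ, ‖(u : ℚ_[3])‖ = 1 ∧ W.realPeriodRat = u * plusPeriod D.f)
    (v₃ : HeightOneSpectrum (𝓞 ℚ)) (hv₃ : ((3 : ℕ) : 𝓞 ℚ) ∈ v₃.asIdeal)
    (hPort : KatoKuriharaPortThreeAt W t v₃)
    (hord : kuriharaVanishingOrder W 3 D.f = 0) :
    ∃ d : ℕ, kuriharaPartialDeepInfty W 3 D.f = d ∧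
      kuriharaPartial W 3 D.f 0 ≤
        ((padicValNat 3 (Nat.card (AddCommGroup.primaryComponent W.sha 3)) + d : ℕ) : ℕ∞) := by
  haveI : Fact (Nat.Prime 3) := ⟨Nat.prime_three⟩
  have h0 : ratPlusSymbol D.f 0 ≠ 0 :=
    ratPlusSymbol_zero_ne_zero_of_kuriharaVanishingOrder_eq_zero W 3 D.f hord
  have hL : W.entireLFunction 1 ≠ 0 :=
    D.isNewformOf.entireLFunction_one_ne_zero_of_ratPlusSymbol_zero_ne_zero h0
  refine deepLower_datum_of_endShapeBound W htower D hper hord (2 * t + 1) ?_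
  intro j' L n hj' hKL hcyc hLn ψ hψ hne hv
  haveI : NeZero n := ⟨hLn.ne_zero⟩
  have hk : L - t - 1 + t + 1 = L := by omega
  have hn' : Kato.IsKolyvaginProduct W 3 (L - t - 1 + t + 1) n := by rw [hk]; exact hLn
  exact exists_LOmega_padicValRat_le_of_towerSurj_deep_of_manin hS24d hS24d₂ hGZK hPT W t (L - t - 1)
    hadd hc3 htower ht hL D hcD hper v₃ hv₃ hPort n hn' (fun ℓ _ hℓ => hcyc.2 ℓ hℓ)
    (fun ℓ hℓ hℓN => (hLn.2 ℓ hℓ).not_dvd_conductorNorm (hNc ▸ hℓN)) (j := j') (by omega) ψ hψ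
    hne hv

/-- **The same for an OPTIMAL datum with `3 ∤ c_D`** (period transfer discharged by
`X4.periodTransfer_of_optimal`), any conductor, every `t`. [cite: Kim2025RefinedTNC, Thm 1.1]
[cite: CremonaAlgorithms1997, §2.8 (p. 26)] [cite: Sakamoto2024, Thm. 4.4 (p. 926)] -/
theorem deepLower_optimal_of_deepPorts_of_manin
    (hS24d : S24Deep.kolyvaginSystems_freeRankOne_zmod_three_pow_deep)
    (hS24d₂ : S24Deep.kolyvaginSystems_idealOfBasis_eq_fittingIdeal_zmod_three_pow_deep)
    (hGZK : rank_eq_analyticRank_of_analyticRank_le_one)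
    (hPT : poitouTate_selmerStructure_duality ℚ)
    (W : WeierstrassCurve ℚ) [W.IsElliptic] [W.IsGloballyMinimal] (t : ℕ)
    (hadd : haveI : Fact (Nat.Prime 3) := ⟨Nat.prime_three⟩; Addv W 3)
    (hc3 : ¬ 3 ∣ (W.baseChange ℚ_[3]).localTamagawaNumber ℤ_[3])
    (htower : ∀ m : ℕ, W.HasSurjectiveModNGaloisRep (3 ^ m : ℕ))
    (ht : Nat.card {Q : (W.baseChange ℚ_[3]).toAffine.Point // (3 : ℕ) • Q = 0} = 3 ^ t)
    {N : ℕ} [NeZero N] (hNc : N = W.conductorNorm ℤ) (D : ModularParametrizationData W N)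
    (hopt : ∀ z ∈ D.L.lattice, ∃ w ∈ periodLattice D.f, z = D.c * w)
    (hcD : ¬ (3 : ℤ) ∣ D.maninConstant)
    (v₃ : HeightOneSpectrum (𝓞 ℚ)) (hv₃ : ((3 : ℕ) : 𝓞 ℚ) ∈ v₃.asIdeal)
    (hPort : KatoKuriharaPortThreeAt W t v₃)
    (hord : kuriharaVanishingOrder W 3 D.f = 0) :
    ∃ d : ℕ, kuriharaPartialDeepInfty W 3 D.f = d ∧
      kuriharaPartial W 3 D.f 0 ≤
        ((padicValNat 3 (Nat.card (AddCommGroup.primaryComponent W.sha 3)) + d : ℕ) : ℕ∞) :=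
  haveI : Fact (Nat.Prime 3) := ⟨Nat.prime_three⟩
  deepLower_datum_of_deepPorts_of_manin hS24d hS24d₂ hGZK hPT W t hadd hc3 htower ht hNc D hcD
    (periodTransfer_of_optimal 3 D hopt hcD) v₃ hv₃ hPort hord

/-! ### Crux-shaped corollary: any newform `f` of `W` at the conductor (multiplicity one), every `t` -/

/-- **Crux 19075's conclusion for EVERY newform `f` of `W` at the level of an optimal datum, every `t`,
any conductor** (the crux binds an arbitrary `f` with `IsNewformOf W f`; by multiplicity one
`IsNewformOf.unique` such an `f` at the datum's level IS `D.f`): GRANTED `hS24d`/`hS24d₂`, `hGZK`,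
`hPT` and the port `KatoKuriharaPortThreeAt W t v₃`, on the stratum {tower onto, ADDITIVE `3`,
`3 ∤ c₃`, `#E(ℚ₃)[3] = 3^t`} with an OPTIMAL datum `D` at the conductor and `3 ∤ c_D`: for every
`f ∈ S₂(Γ₀(N))` with `IsNewformOf W f` and `ord(δ̃_f) = 0`, `∂^{(∞)}_deep(δ̃_f) = d ∈ ℕ` and
`∂⁽⁰⁾(δ̃_f) ≤ ord₃ #Ш(E/ℚ)(3) + d` — the all-`t` analogue of kim3's `deepLower_newform_of_ports`
(the crux's `Finite W.sha` and `3`-integrality binders are not needed: `Ш` finite follows from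
`ord(δ̃) = 0` by GZK inside, integrality is unused). [cite: Kim2025RefinedTNC, Thm 1.1]
[cite: Sakamoto2024, Thm. 4.4 (p. 926)] [cite: Carayol1986] -/
theorem deepLower_newform_of_deepPorts_of_manin
    (hS24d : S24Deep.kolyvaginSystems_freeRankOne_zmod_three_pow_deep)
    (hS24d₂ : S24Deep.kolyvaginSystems_idealOfBasis_eq_fittingIdeal_zmod_three_pow_deep)
    (hGZK : rank_eq_analyticRank_of_analyticRank_le_one)
    (hPT : poitouTate_selmerStructure_duality ℚ)
    (W : WeierstrassCurve ℚ) [W.IsElliptic] [W.IsGloballyMinimal] (t : ℕ)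
    (hadd : haveI : Fact (Nat.Prime 3) := ⟨Nat.prime_three⟩; Addv W 3)
    (hc3 : ¬ 3 ∣ (W.baseChange ℚ_[3]).localTamagawaNumber ℤ_[3])
    (htower : ∀ m : ℕ, W.HasSurjectiveModNGaloisRep (3 ^ m : ℕ))
    (ht : Nat.card {Q : (W.baseChange ℚ_[3]).toAffine.Point // (3 : ℕ) • Q = 0} = 3 ^ t)
    {N : ℕ} [NeZero N] (hNc : N = W.conductorNorm ℤ) (D : ModularParametrizationData W N)
    (hopt : ∀ z ∈ D.L.lattice, ∃ w ∈ periodLattice D.f, z = D.c * w)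
    (hcD : ¬ (3 : ℤ) ∣ D.maninConstant)
    (v₃ : HeightOneSpectrum (𝓞 ℚ)) (hv₃ : ((3 : ℕ) : 𝓞 ℚ) ∈ v₃.asIdeal)
    (hPort : KatoKuriharaPortThreeAt W t v₃)
    (f : CuspForm (Gamma0 N) 2) (hf : IsNewformOf W f) (hord : kuriharaVanishingOrder W 3 f = 0) :
    ∃ d : ℕ, kuriharaPartialDeepInfty W 3 f = d ∧
      kuriharaPartial W 3 f 0 ≤
        ((padicValNat 3 (Nat.card (AddCommGroup.primaryComponent W.sha 3)) + d : ℕ) : ℕ∞) := by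
  obtain rfl : f = D.f := hf.unique D.isNewformOf
  exact deepLower_optimal_of_deepPorts_of_manin hS24d hS24d₂ hGZK hPT W t hadd hc3 htower ht hNc D hopt
    hcD v₃ hv₃ hPort hord


/-! ## ERRATUM (seat w2-c2, 2026-08-26T04:15Z) — VACUOUS PORT

The dictionary port taken by name in this file, `KatoKuriharaPortThreeAt W t v₃` (the universal-closure
PORT), is REFUTED at `t = 0` on every row of its population carrying a unit Kurihara number by cell
n1011's T-PORT-NEG (`Summits/BirchSwinnertonDyer/Rank1Residual/GaloisImage/KatoKuriharaPortThreeRefutation.lean`: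
`not_katoKuriharaPortThreeAt_zero_of_kuriharaNumber_ne_zero`, `not_katoKuriharaPortThreeAt_zero_of_unit`;
the generator-sign anomaly does not depend on `t`). The theorems above are therefore correct but
VACUOUS as rungs of item 19075 and must not be cited as evidence. The repaired statement, keyed to the
shared-generator closure PORT′ `KatoKuriharaPortThreeAtWith W t v₃ η` (the repair designated by
T-PORT-NEG) over a shared-`η` deep family, is `KimAtThreeDeepLowerDeepPortWith.lean`
(`deepLower_{datum,optimal,newform}_of_deepPortsWith`). -/

end Summit.BirchSwinnertonDyer.BirchSwinnertonDyer.Theorems.KimAtThreeDeepLowerDeepPortManin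

end
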